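import Mathlib
import Summits.Ventures.PercRepro2.K5Kernel
import Summits.Ventures.PercRepro2.K5Kron
import Summits.Ventures.PercRepro2.K5Digits
import Summits.Ventures.PercRepro2.K5Theorem
import Summits.Ventures.PercRepro2.PMK5Kernel
import Summits.Ventures.PercRepro2.PMK5Strict
import Summits.Ventures.PercRepro2.PMK5Locus
import Summits.Ventures.PercRepro2.PMK5KernelY
import Summits.Ventures.PercRepro2.PMTypedTri

/-!
# THE SAME-SIDE HARRIS SLACK `SS = P·A − oL·bL` ON `K₅`: the kernel certificate and the equality locus, positive side
(blind cell PercRepro2, mine-2 g24; for Theorem 22 — the equality locus of (HCOV) on the six-vertex family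
`K₅ + a₃ pendant at a root`; on mine-a / typer-1's pendant-at-root identity `PendantRoot.Gc_pendant_root`)

With `a₃` a leaf at the root `a₂` (edge weight `q`) the crux functional is `2 (1 − q) P [q · SS + (1 − q) · Z_H + Z_L]`
in the `a₃`-free masses of `K₅` under `Q = {a₁ ↮ a₂}` (`o = 0, a₁ = 1, a₂ = 2, u = 3, b = 4`), with the two cross
slacks `Z_L, Z_H` of the `a₃`-inactive value and the SAME-SIDE slack `SS = P(Q) P(Q, oL, bL) − P(Q, oL) P(Q, bL)`
(`≥ 0`: `PendantRoot.covC_same_nonneg`, Harris on `C₁`).  `SS` as a degree-3 Bernstein form (third table all-true):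
two products, the certificate **`certSS`** (every coefficient `≥ 0`), the bridge **`ss_eq_bern`**.
**The census** (own code, two methods — the class sums by Kronecker digits, and the exact centre values of `Gc` on
`K₅ + {a₂, a₃}` through the pattern law — identical on all 1,024 edge sets): `SS ≡ 0` on the face of `S` for 480 edge
sets, EXACTLY the `SS`-DEGENERATE ones (`RuleSS`): ¬[o ~ b avoiding {a₁, a₂}] ∨ ¬[o ~ a₁ avoiding {a₂}] — the root
pair separates `o` from `b`, or `a₁` cannot reach `o` avoiding `a₂` (the `a₁`-clause of `RuleA`, the `a₂`-clause gone);
SEVEN minimal nonzero supports (2–3 edges: {oa₁ ob}, {ou ob a₁u}, {ob a₁b}, {oa₁ ou ub}, {ou a₁u ub}, {ob a₁u ub},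
{ou a₁b ub}); 96,120 positive profiles of `4^10`, 0 negative, maximum 1,420; **`RuleSS ⊆ RuleA`** (480 ⊆ 560).
**`ss_K5_pos_of_face`** (this file): on every non-`SS`-degenerate edge set `SS > 0` at every weight vector interior on
it — 7 witness digits (`digSS`), the covering `coverSS`, face positivity of the Bernstein basis.  The zero side and the
«iff»s are in `PMK5LocusZeroSS.lean`.  Standard axioms.
-/

namespace Summit.Ventures.PercRepro2

open Hub CovForm

namespace K5

namespace PM

/-! ## The Kronecker numbers and the certificate -/

/-- The positive part of `SS`: `P·A` (times the all-true table). -/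
def kPosSS : ℕ := kron tQ * kron tQLoBL * kron tOne

/-- The negative part of `SS`: `oL·bL`. -/
def kNegSS : ℕ := kron tQLo * kron tQBL * kron tOne

set_option maxRecDepth 100000 in
set_option maxHeartbeats 0 in
/-- **The `K₅` certificate of the same-side slack**: `kPosSS ≥ kNegSS` digitwise. -/
theorem certSS : kNegSS ≤ kPosSS ∧ Nat.land (kPosSS - kNegSS) mask = 0 ∧ Nat.land kNegSS mask = 0 := by
  decide +kernel

/-- The positive triple counts of `SS`. -/
def cntPosSS (k : Fin 10 → Fin 4) : ℕ := cnt3 tQ tQLoBL tOne k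

/-- The negative triple counts of `SS`. -/
def cntNegSS (k : Fin 10 → Fin 4) : ℕ := cnt3 tQLo tQBL tOne k

/-- `kPosSS` carries the positive counts. -/
lemma kPosSS_eq : kPosSS = ∑ k, cntPosSS k * KB ^ idx4 k := by
  unfold kPosSS cntPosSS
  rw [kron_eq_kronSum tQ, kron_eq_kronSum tQLoBL, kron_eq_kronSum tOne, kronSum_mul_mul]

/-- `kNegSS` carries the negative counts. -/
lemma kNegSS_eq : kNegSS = ∑ k, cntNegSS k * KB ^ idx4 k := by
  unfold kNegSS cntNegSS
  rw [kron_eq_kronSum tQLo, kron_eq_kronSum tQBL, kron_eq_kronSum tOne, kronSum_mul_mul]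

/-- The counts are bounded by `3^10 < 2^19`. -/
lemma cntPosSS_lt (k : Fin 10 → Fin 4) : cntPosSS k < 2 ^ 19 := by
  unfold cntPosSS
  have := cnt3_le tQ tQLoBL tOne k
  omega

/-- The counts are bounded by `3^10 < 2^19`. -/
lemma cntNegSS_lt (k : Fin 10 → Fin 4) : cntNegSS k < 2 ^ 19 := by
  unfold cntNegSS
  have := cnt3_le tQLo tQBL tOne k
  omega

/-- **Every Bernstein coefficient of `SS` on `K₅` is `≥ 0`** (from `certSS`). -/
theorem cntNegSS_le_cntPosSS (k : Fin 10 → Fin 4) : cntNegSS k ≤ cntPosSS k :=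
  le_of_kron_le cntPosSS cntNegSS cntPosSS_lt cntNegSS_lt kPosSS_eq kNegSS_eq certSS.1 certSS.2.1 k

section Bernstein

variable {R : Type*} [Field R] [LinearOrder R] [IsStrictOrderedRing R]

omit [LinearOrder R] [IsStrictOrderedRing R] in
/-- **The same-side slack on `K₅` in the degree-3 Bernstein basis.** -/
theorem ss_eq_bern (p : Fin 10 → R) :
    prob p (avoidAll ends5 2 {1}) * prob p (avoidAll ends5 2 {1} ∩ (connEvent ends5 1 0 ∩ connEvent ends5 1 4)) -
        prob p (avoidAll ends5 2 {1} ∩ connEvent ends5 1 0) * prob p (avoidAll ends5 2 {1} ∩ connEvent ends5 1 4) =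
      ∑ k, bern p k * ((cntPosSS k : ℕ) - (cntNegSS k : ℕ) : R) := by
  rw [prob_eq_bform p _ _ tQ_iff, prob_eq_bform p _ _ tQLoBL_iff, prob_eq_bform p _ _ Pendant.tQLo_iff',
    prob_eq_bform p _ _ tQBL_iff]
  have e : ∀ P A oL bL one : R, one = 1 → P * A - oL * bL = P * A * one - oL * bL * one := by
    intros; subst_vars; ring
  rw [e _ _ _ _ (bform p (indR tOne)) (one_eq_bform p).symm, bform_mul_mul, bform_mul_mul,
    ← Finset.sum_sub_distrib]
  refine Finset.sum_congr rfl fun k _ => ?_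
  rw [coef3_eq_cnt3, coef3_eq_cnt3]
  unfold cntPosSS cntNegSS
  ring

end Bernstein

/-! ## The witness digits (kernel) -/

set_option maxRecDepth 100000 in
/-- The class sums of `SS` at the 7 witness profiles, read off the Kronecker digits of `kPosSS − kNegSS`. -/
theorem digSS : (kPosSS - kNegSS) / KB ^ 129 % KB = 2 ∧
    (kPosSS - kNegSS) / KB ^ 2208 % KB = 6 ∧
    (kPosSS - kNegSS) / KB ^ 4224 % KB = 2 ∧
    (kPosSS - kNegSS) / KB ^ 524321 % KB = 4 ∧
    (kPosSS - kNegSS) / KB ^ 525344 % KB = 4 ∧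
    (kPosSS - kNegSS) / KB ^ 526464 % KB = 6 ∧
    (kPosSS - kNegSS) / KB ^ 528416 % KB = 4 := by
  decide +kernel

/-- Witness 0: the profile of index `129` (support `{oa1 ob}`, mask `9`) has the `SS`-class sum `2`. -/
theorem wSS0 : cntNegSS (decode4 129) < cntPosSS (decode4 129) :=
  digit_lt_of_kron cntPosSS cntNegSS cntPosSS_lt cntNegSS_le_cntPosSS kPosSS_eq kNegSS_eq 129
    (by norm_num) digSS.1 (by norm_num)
/-- Witness 1: the profile of index `2208` (support `{ou ob a1u}`, mask `44`) has the `SS`-class sum `6`. -/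
theorem wSS1 : cntNegSS (decode4 2208) < cntPosSS (decode4 2208) :=
  digit_lt_of_kron cntPosSS cntNegSS cntPosSS_lt cntNegSS_le_cntPosSS kPosSS_eq kNegSS_eq 2208
    (by norm_num) digSS.2.1 (by norm_num)
/-- Witness 2: the profile of index `4224` (support `{ob a1b}`, mask `72`) has the `SS`-class sum `2`. -/
theorem wSS2 : cntNegSS (decode4 4224) < cntPosSS (decode4 4224) :=
  digit_lt_of_kron cntPosSS cntNegSS cntPosSS_lt cntNegSS_le_cntPosSS kPosSS_eq kNegSS_eq 4224
    (by norm_num) digSS.2.2.1 (by norm_num)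
/-- Witness 3: the profile of index `524321` (support `{oa1 ou ub}`, mask `517`) has the `SS`-class sum `4`. -/
theorem wSS3 : cntNegSS (decode4 524321) < cntPosSS (decode4 524321) :=
  digit_lt_of_kron cntPosSS cntNegSS cntPosSS_lt cntNegSS_le_cntPosSS kPosSS_eq kNegSS_eq 524321
    (by norm_num) digSS.2.2.2.1 (by norm_num)
/-- Witness 4: the profile of index `525344` (support `{ou a1u ub}`, mask `548`) has the `SS`-class sum `4`. -/
theorem wSS4 : cntNegSS (decode4 525344) < cntPosSS (decode4 525344) :=
  digit_lt_of_kron cntPosSS cntNegSS cntPosSS_lt cntNegSS_le_cntPosSS kPosSS_eq kNegSS_eq 525344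
    (by norm_num) digSS.2.2.2.2.1 (by norm_num)
/-- Witness 5: the profile of index `526464` (support `{ob a1u ub}`, mask `552`) has the `SS`-class sum `6`. -/
theorem wSS5 : cntNegSS (decode4 526464) < cntPosSS (decode4 526464) :=
  digit_lt_of_kron cntPosSS cntNegSS cntPosSS_lt cntNegSS_le_cntPosSS kPosSS_eq kNegSS_eq 526464
    (by norm_num) digSS.2.2.2.2.2.1 (by norm_num)
/-- Witness 6: the profile of index `528416` (support `{ou a1b ub}`, mask `580`) has the `SS`-class sum `4`. -/
theorem wSS6 : cntNegSS (decode4 528416) < cntPosSS (decode4 528416) :=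
  digit_lt_of_kron cntPosSS cntNegSS cntPosSS_lt cntNegSS_le_cntPosSS kPosSS_eq kNegSS_eq 528416
    (by norm_num) digSS.2.2.2.2.2.2 (by norm_num)

/-- The Kronecker indices of the 7 witness profiles (one per minimal support). -/
def NSS : Fin 7 → ℕ := ![129, 2208, 4224, 524321, 525344, 526464, 528416]

/-- The supports of the 7 witness profiles, as edge bitmasks. -/
def WSS : Fin 7 → ℕ := ![9, 44, 72, 517, 548, 552, 580]

/-- Every witness coefficient of `SS` is strictly positive. -/
theorem witnessSS_lt : ∀ i : Fin 7, cntNegSS (decode4 (NSS i)) < cntPosSS (decode4 (NSS i)) := by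
  intro i
  fin_cases i
  exacts [wSS0, wSS1, wSS2, wSS3, wSS4, wSS5, wSS6]

set_option maxRecDepth 100000 in
/-- The support of the `i`-th witness profile is the mask `WSS i`. -/
theorem supp_WSS : ∀ i : Fin 7, ∀ e : Fin 10, decode4 (NSS i) e ≠ 0 → (WSS i).testBit e = true := by
  decide +kernel

/-- **The `SS`-degenerate edge sets** — the exact zero set of the same-side slack on `K₅`: the root pair separates `o`
from `b`, or `a₁` cannot reach `o` avoiding `a₂`. -/
def RuleSS (m : ℕ) : Bool :=
  (!conn (cfgAvoid2 m 1 2) 0 4) || (!conn (cfgAvoid m 2) 0 1)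

set_option maxRecDepth 100000 in
/-- **The covering**: every non-`SS`-degenerate edge set contains the support of a witness profile. -/
theorem coverSS : ∀ m : Fin 1024, RuleSS m = false →
    ∃ i : Fin 7, ∀ e : Fin 10, (WSS i).testBit e = true → (m : ℕ).testBit e = true := by
  decide +kernel

section Face

variable {R : Type*} [Field R] [LinearOrder R] [IsStrictOrderedRing R]

/-- **THE EQUALITY LOCUS OF THE SAME-SIDE SLACK — THE POSITIVE SIDE (Bernstein form).** -/
theorem ss_K5_pos_of_face (m : ℕ) (hm : m < 1024) (hr : RuleSS m = false) (q : Fin 10 → R)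
    (hq₁ : ∀ e : Fin 10, m.testBit e = true → 0 < q e ∧ q e < 1)
    (hq₀ : ∀ e : Fin 10, m.testBit e = false → q e = 0) :
    0 < ∑ k, bern q k * ((cntPosSS k : ℕ) - (cntNegSS k : ℕ) : R) := by
  obtain ⟨i, hi⟩ := coverSS ⟨m, hm⟩ hr
  have hk := witnessSS_lt i
  have hs : ∀ e : Fin 10, decode4 (NSS i) e ≠ 0 → m.testBit e = true := fun e he => hi e (supp_WSS i e he)
  have hb : 0 < bern q (decode4 (NSS i)) := bern_pos_of_face hq₁ hq₀ _ hs
  have h01 : ∀ e, 0 ≤ q e ∧ q e ≤ 1 := fun e => by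
    by_cases he : m.testBit e = true
    · exact ⟨(hq₁ e he).1.le, (hq₁ e he).2.le⟩
    · rw [hq₀ e (by simpa using he)]
      exact ⟨le_rfl, zero_le_one⟩
  calc (0 : R) < bern q (decode4 (NSS i)) * ((cntPosSS (decode4 (NSS i)) : ℕ) - (cntNegSS (decode4 (NSS i)) : ℕ) : R) := by
        apply mul_pos hb
        rw [sub_pos]
        exact_mod_cast hk
    _ ≤ ∑ k, bern q k * ((cntPosSS k : ℕ) - (cntNegSS k : ℕ) : R) :=
        Finset.single_le_sum (f := fun k => bern q k * ((cntPosSS k : ℕ) - (cntNegSS k : ℕ) : R))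
          (fun k _ => mul_nonneg (bern_nonneg h01 k) (by rw [sub_nonneg]; exact_mod_cast cntNegSS_le_cntPosSS k))
          (Finset.mem_univ _)

end Face

end PM

end K5

end Summit.Ventures.PercRepro2
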